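import Literature.Barriers.QuantumAdvantage.ChaoticDynamicsCopies
import Mathlib.Analysis.SpecialFunctions.Pow.Real
import Mathlib.Analysis.SpecialFunctions.Exp
import HarnessLib

/-!
# Barrier: copy lower bounds for quantum simulation of fluid dynamics — KdV `Ω(T²)`, incompressible Euler `e^{Ω(T)}` (Ameri–Carolan–Childs–Krovi 2026, Lemma 10, Cor. 11–12, Thms 15 / 24–25)

D-0021 barrier file for the summit `QuantumAdvantage` (cell `pub-qadeq`, CFD / nonlinear-PDE lane:
CLAIMS rows A-195 (this paper), A-14 Navier–Stokes, A-142 Carleman lattice Boltzmann / OPEN-38,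
A-167 Stokes via Schrödingerisation, A-183 Koopman–von Neumann plasma Kelvin–Helmholtz, A-13).
HONEST FRAMING: instance-level adjudication of specific advantage claims; no claim about BQP vs BPP
or the summit.

**Source.** A. Ameri, J. Carolan, A. M. Childs, H. Krovi, *Quantum lower bounds for simulating
fluid dynamics*, arXiv:2603.12161v1 (12 Mar 2026) [AmeriCarolanChildsKrovi2026]. Materialised text
`paper:arxiv-2603.12161` (chunks p0015–p0018 = §2.4–§2.5, p0032 = Thm 15, p0048 = Thm 24,
p0051–p0053 = Thms 25–26).

* §2.5 Lemma 10 (p0017): "Let `M` be an operator taking pure states to pure states, and `|ψ⟩`,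
  `|φ⟩` be quantum states satisfying `D(ρ_ψ, ρ_φ) = ε₀`. Suppose that
  `D(M(ρ_ψ), M(ρ_φ)) = ε_f`. Then any quantum algorithm implementing `M` to precision `δ < ε_f/2`
  uses at least `k ≥ ((ε_f − 2δ)/ε₀)²` copies. *Proof.* … triangle inequality …
  `D(A(ρ_ψ^{⊗k}), A(ρ_φ^{⊗k})) ≤ D(ρ_ψ^{⊗k}, ρ_φ^{⊗k})` (Lemma 5) `≤ √k · ε₀` (Lemma 4)."
* Corollary 11 (p0017): exactly evolving for time `T` requires
  `k = Ω((d(v(T), v′(T)) / d(v(0), v′(0)))²)` copies.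
* Corollary 12 (p0018): if `|⟨v(0)|v′(0)⟩| = 1 − O(ε)`, `|⟨v(T)|v′(T)⟩| = 1 − Ω(ε^α)` with
  `T = O(log(1/ε))`, `0 < α < 1`, then exact simulation needs `k = e^{Ω(T)}` copies.
* Theorem 15 (p0032): "any quantum algorithm for simulating the KdV equation, as outlined in
  Problem 1, for time `T` to error at most `1/C` requires `Ω(T²)` copies of the initial state"
  (§3: two single solitons of speeds `1` and `1 + δ` are `O(δ)` apart initially (Lemma 13) and
  `Ω(1)` apart after time `T = Θ(1/δ)` (Lemma 14)).
* Theorems 24 / 25 (p0048 / p0051): "any quantum algorithm for simulating the incompressible Euler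
  equations, as outlined in Problem 2 [resp. 3], for time `T` to error at most `e^{−CT}` requires
  `e^{Ω(T)}` copies of the initial state" (§4: smooth Kelvin–Helmholtz shear layer; linear
  instability with rate `λ`; rigorous linearisation-error bound).
* Theorem 26 / Corollary 27 (p0052): history-state preparation needs `Ω(f(T)/T)` copies.

Structured summary (D-0021):
* technique_class: ANY quantum algorithm that consumes `k` copies of the amplitude-encoded initial
  data (the subnormalised / tensor-product / direct-sum encodings of Problems 1–3, p0015–p0016) and
  applies a trace-preserving operation — the tree's `ChaoticDynamicsCopies.CopyAlgorithm k X m ι`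
  with an arbitrary output effect; only input copies are counted, so Carleman / KvN / LCHS /
  Schrödingerisation / QLSA-based and time-marching solvers are all inside
  [cite: AmeriCarolanChildsKrovi2026, §2.5 Lemma 10 ("any quantum algorithm implementing M")].
* blocks: poly(`T`)-copy quantum algorithms whose OUTPUT is the normalised final-time (or history)
  state of (i) the KdV equation at constant error — `Ω(T²)` copies, Thm 15; (ii) the incompressible
  Euler equations at error `e^{−CT}` — `e^{Ω(T)}` copies, Thms 24–25; the CFD speedup sentences of
  rows A-14 / A-142 / A-183 in so far as they promise normalised-state output at such accuracies
  [cite: AmeriCarolanChildsKrovi2026, Thms 15, 24, 25, 26].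
* because: Helstrom + contractivity — on `k` copies two initial encodings with pure-state trace
  distance `ε₀` stay `√k·ε₀`-indistinguishable under every effect after every trace-preserving map,
  while an algorithm `δ`-close to targets at distance `ε_f` separates them by `≥ ε_f − 2δ`; hence
  `k ≥ ((ε_f − 2δ)/ε₀)²` [cite: AmeriCarolanChildsKrovi2026, §2.5 Lemma 10]. PROVED below:
  `pureDist_tensorPower_le` (Lemma 4), `effectGap_copies_le_sqrt_mul` (Lemma 4 in effect form), `outputGap_le_sqrt_mul`
  (Lemma 5 step), `copies_ge_sq_div` (Lemma 10), `copies_ge_sq_div_exact` (Cor. 11),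
  `copies_quadratic_in_time` (the Thm-15 calibration `ε₀ ≤ C/T`, `ε_f − 2δ ≥ g`),
  `copies_exponential_in_time` (the Cor.-12 / Thm-24 calibration `ε₀ ≤ C e^{−aT}`,
  `ε_f − 2δ ≥ c e^{−bT}`, `b < a`).
* evasions_known: (i) DISSIPATIVE regimes (Navier–Stokes at moderate Reynolds number; Liu et al.
  PNAS 2021 `R < 1`, tree `Literature.Analysis.ODE.CarlemanTruncation`) — the paper's bounds are for
  the dissipationless KdV / Euler equations only and give nothing in the Reynolds number
  [cite: AmeriCarolanChildsKrovi2026, §1.1.2 p0007 and §2.3 p0015 ("we expect our lower bound to apply … for sufficiently larger Re, but we leave a detailed exploration of this for future work")];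
  (ii) outputs that are NOT the normalised state (single functionals to inverse-polynomial error)
  are constrained only through the state-discrimination power they retain — as for the Lewis et al.
  barrier [cite: LewisEtAl2024, §5]; (iii) "there may still be special classes of fluid equations
  that can be simulated efficiently" [cite: AmeriCarolanChildsKrovi2026, §1.1.2 p0007].
* scope_caveats: (a) the Euler bound is exponential ONLY at output error `e^{−CT}`: the unstable
  perturbation is taken small enough for the linearisation-error bound, so the two target states are
  themselves only `e^{−cT}`-type apart (`ε_f = Ω(ε^α)` in Cor. 12) — at CONSTANT output error the
  paper proves nothing exponential for Euler (the constant-error exponential statement for an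
  explicit ODE family is Lewis et al. 2024, tree `ChaoticDynamicsCopies.copies_exponential_in_time`);
  (b) KdV's `Ω(T²)` IS at constant error; (c) the PDE analysis (Lemmas 13–14, Thms 16–22: soliton
  divergence, Kelvin–Helmholtz linear instability, linearisation error) is NOT formalised here and
  enters the theorems below only as the hypotheses on `ε₀` and on the target separation; (d) the
  folklore reading "quantum computers cannot simulate fluids" over-claims: worst-case families, state
  output, dissipationless models [cite: AmeriCarolanChildsKrovi2026, §1 ("in general"), §6].
* status: established as mathematics (the information-theoretic core is elementary and proved below;
  the PDE premises are refereed-grade analysis but the paper is an UNREFEREED preprint, v1 Mar 2026).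

What is here (all proved, 0 named facts, 0 sorry): ACCK's pure-state trace distance
`pureDist ψ φ = √(1 − ‖⟨ψ|φ⟩‖²)` (§2.1 eq. (21)–(22) for pure states) with `pureDist_tensorPower_le`
(Lemma 4: `D(ψ^{⊗k}, φ^{⊗k}) ≤ √k·D(ψ, φ)`); the effect / `CopyAlgorithm` forms of Lemmas 4–5;
Lemma 10 and Corollary 11 with the printed constants; the two time calibrations.

## References
* [AmeriCarolanChildsKrovi2026] A. Ameri, J. Carolan, A. M. Childs, H. Krovi, arXiv:2603.12161v1,
  §2.5 Lemma 10, Cor. 11–12; §3 Thm 15; §4 Thms 24–25; §5 Thm 26.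
* [LewisEtAl2024] D. Lewis, S. Eidenbenz, B. Nadiga, Y. Subaşı, Quantum 8, 1509 (2024) — the tree's
  `ChaoticDynamicsCopies` (technique class `CopyAlgorithm`, `outputGap_le`).
* [NielsenChuang2010] Nielsen–Chuang §9.2.3 (trace distance of pure states), §8.2.3.
* [Barnett2009] S. Barnett, *Quantum Information*, §4.4 (pure-state Helstrom bound; tree file
  `PureStateHelstromBound`).
-/

noncomputable section

open scoped BigOperators ComplexOrder
open Matrix Finset

namespace Literature.Barriers.QuantumAdvantage.FluidDynamicsCopies

open Literature.InformationTheory.StateDiscrimination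
open Literature.InformationTheory.StateDiscrimination.TensorPowerDiscrimination
  (tensorPower star_tensorPower_dotProduct tensorPower_normSq)
open Literature.Barriers.QuantumAdvantage.ChaoticDynamicsCopies

variable {X : Type*} [Fintype X]

/-! ### 1. Pure-state trace distance and ACCK Lemma 4 (`k` copies cost at most `√k`) -/

/-- ACCK's trace distance `D(ρ_ψ, ρ_φ)` specialised to pure states given as vectors:
`D = √(1 − |⟨ψ|φ⟩|²)` (for unit `ψ, φ`). [cite: AmeriCarolanChildsKrovi2026, §2.1 eqs. (21)–(22)]; [cite: NielsenChuang2010, §9.2.3] -/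
def pureDist (ψ φ : X → ℂ) : ℝ := Real.sqrt (1 - ‖star ψ ⬝ᵥ φ‖ ^ 2)

/-- `D ≥ 0`. [folklore] -/
private theorem pureDist_nonneg (ψ φ : X → ℂ) : 0 ≤ pureDist ψ φ := Real.sqrt_nonneg _

/-- Bernoulli step of Lemma 4: for `0 ≤ x`, `1 − x^k ≤ k (1 − x)`. [folklore] -/
private theorem one_sub_pow_le_mul {x : ℝ} (hx0 : 0 ≤ x) (k : ℕ) :
    1 - x ^ k ≤ k * (1 - x) := by
  have hB := one_add_mul_le_pow (show (-2 : ℝ) ≤ x - 1 by linarith) k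
  rw [add_sub_cancel] at hB
  linarith

/-- **Lemma 4 (pure states): `D(ψ^{⊗k}, φ^{⊗k}) ≤ √k · D(ψ, φ)`.**
[cite: AmeriCarolanChildsKrovi2026, §2.5 proof of Lemma 10 ("≤ √k · ε₀ (Lemma 4)")] -/
theorem pureDist_tensorPower_le (ψ φ : X → ℂ) (k : ℕ) :
    pureDist (tensorPower ψ k) (tensorPower φ k) ≤ Real.sqrt k * pureDist ψ φ := by
  unfold pureDist
  rw [star_tensorPower_dotProduct, norm_pow, ← pow_mul, ← Real.sqrt_mul (Nat.cast_nonneg k)]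
  refine Real.sqrt_le_sqrt ?_
  have h2 : ‖star ψ ⬝ᵥ φ‖ ^ (k * 2) = (‖star ψ ⬝ᵥ φ‖ ^ 2) ^ k := by rw [mul_comm, pow_mul]
  rw [h2]
  exact one_sub_pow_le_mul (by positivity) k

variable [DecidableEq X]

/-- **Lemma 4 in effect form.** For unit `ψ, φ` and ANY effect `E` on the `k`-copy register,
`Re⟨ψ^{⊗k}|E|ψ^{⊗k}⟩ − Re⟨φ^{⊗k}|E|φ^{⊗k}⟩ ≤ √k · D(ψ, φ)`.
[cite: AmeriCarolanChildsKrovi2026, §2.5 Lemma 10 (proof, eqs. (88)–(89))]; [cite: Barnett2009, §4.4 eqs. (4.55)–(4.58)] -/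
theorem effectGap_copies_le_sqrt_mul {k : ℕ} {E : Matrix (Fin k → X) (Fin k → X) ℂ}
    (hE : E.PosSemidef) (hE' : (1 - E).PosSemidef) {ψ φ : X → ℂ} (hψ : star ψ ⬝ᵥ ψ = 1)
    (hφ : star φ ⬝ᵥ φ = 1) :
    (star (tensorPower ψ k) ⬝ᵥ (E *ᵥ tensorPower ψ k)).re
      - (star (tensorPower φ k) ⬝ᵥ (E *ᵥ tensorPower φ k)).re ≤ Real.sqrt k * pureDist ψ φ := by
  have hgap := PureStateHelstromBound.effect_gap_le_sqrt hE hE' (tensorPower_normSq hψ k)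
    (tensorPower_normSq hφ k)
  exact hgap.trans (pureDist_tensorPower_le ψ φ k)

variable {m ι : Type*} [Fintype m] [DecidableEq m] [Fintype ι]

/-- **Lemma 5 step (contractivity) for a `CopyAlgorithm`.** For any trace-preserving algorithm on
the `k` copies and any output effect `P`, the two outputs are separated by at most `√k · D(ψ, φ)`.
[cite: AmeriCarolanChildsKrovi2026, §2.5 Lemma 10 (proof, eq. (88): "D(A(ρ_ψ^{⊗k}), A(ρ_φ^{⊗k})) ≤ D(ρ_ψ^{⊗k}, ρ_φ^{⊗k}) (Lemma 5)")]; [cite: NielsenChuang2010, §9.2.1 Thm 9.2] -/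
theorem outputGap_le_sqrt_mul {k : ℕ} (𝓐 : CopyAlgorithm k X m ι) {P : Matrix m m ℂ}
    (hP : P.PosSemidef) (hP' : (1 - P).PosSemidef) {ψ φ : X → ℂ} (hψ : star ψ ⬝ᵥ ψ = 1)
    (hφ : star φ ⬝ᵥ φ = 1) :
    (P * 𝓐.output (tensorPower ψ k)).trace.re - (P * 𝓐.output (tensorPower φ k)).trace.re
      ≤ Real.sqrt k * pureDist ψ φ := by
  rw [𝓐.trace_mul_output, 𝓐.trace_mul_output]
  obtain ⟨h1, h2⟩ := 𝓐.dual_effect hP hP'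
  exact effectGap_copies_le_sqrt_mul h1 h2 hψ hφ

/-! ### 2. ACCK Lemma 10 and Corollary 11 -/

/-- **Lemma 10 (copy lower bound, printed constant).** Let a `CopyAlgorithm` on `k` copies be
`δ`-accurate on the two inputs in the operational sense — every effect's expectation on its output
is within `δ` of its value on the pure target `u` (resp. `v`) — where the targets are at pure-state
trace distance `ε_f = D(u, v)` and the inputs at `ε₀ = D(ψ, φ) > 0`. If `2δ ≤ ε_f` then
`((ε_f − 2δ)/ε₀)² ≤ k` ("any quantum algorithm implementing M to precision δ < ε_f/2 uses at least
k ≥ ((ε_f − 2δ)/ε₀)² copies"). [cite: AmeriCarolanChildsKrovi2026, §2.5 Lemma 10] -/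
theorem copies_ge_sq_div {k : ℕ} (𝓐 : CopyAlgorithm k X m ι) {ψ φ : X → ℂ}
    (hψ : star ψ ⬝ᵥ ψ = 1) (hφ : star φ ⬝ᵥ φ = 1) (hε0 : 0 < pureDist ψ φ)
    {u v : m → ℂ} (hu : star u ⬝ᵥ u = 1) (hv : star v ⬝ᵥ v = 1) {δ : ℝ}
    (hδ : 2 * δ ≤ pureDist u v)
    (hψout : ∀ P : Matrix m m ℂ, P.PosSemidef → (1 - P).PosSemidef →
      |(P * 𝓐.output (tensorPower ψ k)).trace.re - (star u ⬝ᵥ (P *ᵥ u)).re| ≤ δ)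
    (hφout : ∀ P : Matrix m m ℂ, P.PosSemidef → (1 - P).PosSemidef →
      |(P * 𝓐.output (tensorPower φ k)).trace.re - (star v ⬝ᵥ (P *ᵥ v)).re| ≤ δ) :
    ((pureDist u v - 2 * δ) / pureDist ψ φ) ^ 2 ≤ k := by
  -- the Helstrom effect of the targets realises the gap `ε_f`
  obtain ⟨E, hE, hE', hgap⟩ := PureStateHelstromBound.effect_gap_eq_sqrt_exists hu hv
  have hout := outputGap_le_sqrt_mul 𝓐 hE hE' hψ hφ
  have h1 := hψout E hE hE'
  have h2 := hφout E hE hE'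
  rw [abs_le] at h1 h2
  have htar : (star u ⬝ᵥ (E *ᵥ u)).re - (star v ⬝ᵥ (E *ᵥ v)).re = pureDist u v := hgap
  -- `ε_f − 2δ ≤ √k ε₀`
  have hle : pureDist u v - 2 * δ ≤ Real.sqrt k * pureDist ψ φ := by linarith
  have hdiv : (pureDist u v - 2 * δ) / pureDist ψ φ ≤ Real.sqrt k := by
    rw [div_le_iff₀ hε0]; exact hle
  have hsq := pow_le_pow_left₀ (div_nonneg (by linarith) (le_of_lt hε0)) hdiv 2
  rwa [Real.sq_sqrt (Nat.cast_nonneg k)] at hsq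

/-- **Corollary 11 (exact evolution).** An algorithm whose outputs ARE the pure targets `u, v`
needs `(D(u, v)/D(ψ, φ))² ≤ k` copies ("exactly evolving for time T … requires
`k = Ω((d(v(T), v′(T))/d(v(0), v′(0)))²)` copies"; here with the printed constant `1` in the pure
trace distance `D = √(1 − |⟨·|·⟩|²)`, which is within a factor `√2` of the Euclidean `d` of eq. (21)).
[cite: AmeriCarolanChildsKrovi2026, §2.5 Corollary 11] -/
theorem copies_ge_sq_div_exact {k : ℕ} (𝓐 : CopyAlgorithm k X m ι) {ψ φ : X → ℂ}
    (hψ : star ψ ⬝ᵥ ψ = 1) (hφ : star φ ⬝ᵥ φ = 1) (hε0 : 0 < pureDist ψ φ)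
    {u v : m → ℂ} (hu : star u ⬝ᵥ u = 1) (hv : star v ⬝ᵥ v = 1)
    (hout : 𝓐.output (tensorPower ψ k) = vecMulVec u (star u))
    (hout' : 𝓐.output (tensorPower φ k) = vecMulVec v (star v)) :
    (pureDist u v / pureDist ψ φ) ^ 2 ≤ k := by
  have h := copies_ge_sq_div 𝓐 hψ hφ hε0 hu hv (δ := 0) (by simpa using pureDist_nonneg u v)
    (fun P _ _ => by
      rw [hout, mul_vecMulVec, trace_vecMulVec, dotProduct_comm _ (star u), sub_self, abs_zero])
    (fun P _ _ => by
      rw [hout', mul_vecMulVec, trace_vecMulVec, dotProduct_comm _ (star v), sub_self, abs_zero])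
  simpa using h

/-! ### 3. The two time calibrations (Theorem 15 and Corollary 12 / Theorem 24 shapes) -/

/-- **KdV calibration (Theorem 15 shape): `Ω(T²)` copies.** If the two initial encodings are
`D(ψ, φ) ≤ C/T` apart (two solitons of speeds `1`, `1 + δ` with `δ = Θ(1/T)`, Lemma 13) while a
`δ'`-accurate algorithm must produce targets with `D(u, v) − 2δ' ≥ g > 0` (Lemma 14: constant
separation after time `T`; accuracy `1/C`), then `(gT/C)² ≤ k`.
[cite: AmeriCarolanChildsKrovi2026, §3 Theorem 15 with Lemmas 13–14 and Corollary 11] -/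
theorem copies_quadratic_in_time {k : ℕ} (𝓐 : CopyAlgorithm k X m ι) {ψ φ : X → ℂ}
    (hψ : star ψ ⬝ᵥ ψ = 1) (hφ : star φ ⬝ᵥ φ = 1) (hε0 : 0 < pureDist ψ φ)
    {C T : ℝ} (hC : 0 < C) (hT : 0 < T) (hinit : pureDist ψ φ ≤ C / T)
    {u v : m → ℂ} (hu : star u ⬝ᵥ u = 1) (hv : star v ⬝ᵥ v = 1) {δ g : ℝ} (hg : 0 < g)
    (hsep : g ≤ pureDist u v - 2 * δ)
    (hψout : ∀ P : Matrix m m ℂ, P.PosSemidef → (1 - P).PosSemidef →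
      |(P * 𝓐.output (tensorPower ψ k)).trace.re - (star u ⬝ᵥ (P *ᵥ u)).re| ≤ δ)
    (hφout : ∀ P : Matrix m m ℂ, P.PosSemidef → (1 - P).PosSemidef →
      |(P * 𝓐.output (tensorPower φ k)).trace.re - (star v ⬝ᵥ (P *ᵥ v)).re| ≤ δ) :
    (g * T / C) ^ 2 ≤ k := by
  have hδ : 2 * δ ≤ pureDist u v := by linarith
  have h := copies_ge_sq_div 𝓐 hψ hφ hε0 hu hv hδ hψout hφout
  refine le_trans ?_ h
  apply pow_le_pow_left₀ (by positivity)
  -- `gT/C ≤ (ε_f − 2δ)/ε₀` since `ε₀ ≤ C/T` and `g ≤ ε_f − 2δ`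
  rw [div_le_div_iff₀ hC hε0]
  calc g * T * pureDist ψ φ ≤ g * T * (C / T) :=
        mul_le_mul_of_nonneg_left hinit (by positivity)
    _ = g * C := by field_simp
    _ ≤ (pureDist u v - 2 * δ) * C := mul_le_mul_of_nonneg_right hsep (le_of_lt hC)

/-- **Euler calibration (Corollary 12 / Theorem 24 shape): `e^{Ω(T)}` copies even at exponentially
small output error.** If the initial encodings are `D(ψ, φ) ≤ C e^{−aT}` apart (equilibrium vs.
equilibrium + a perturbation of size `e^{−aT}`), and a `δ`-accurate algorithm must produce targets
with `D(u, v) − 2δ ≥ c e^{−bT}` (the perturbation grown by the Kelvin–Helmholtz instability, still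
exponentially small so that linearisation is controlled; accuracy `δ = e^{−CT}`-type), with
`b < a`, then `(c/C)² e^{2(a−b)T} ≤ k`.
[cite: AmeriCarolanChildsKrovi2026, §2.5 Corollary 12 and §4.4 Theorem 24 ("to error at most e^{−CT} requires e^{Ω(T)} copies")] -/
theorem copies_exponential_in_time {k : ℕ} (𝓐 : CopyAlgorithm k X m ι) {ψ φ : X → ℂ}
    (hψ : star ψ ⬝ᵥ ψ = 1) (hφ : star φ ⬝ᵥ φ = 1) (hε0 : 0 < pureDist ψ φ)
    {C a b c T : ℝ} (hC : 0 < C) (hc : 0 < c) (hinit : pureDist ψ φ ≤ C * Real.exp (-(a * T)))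
    {u v : m → ℂ} (hu : star u ⬝ᵥ u = 1) (hv : star v ⬝ᵥ v = 1) {δ : ℝ}
    (hsep : c * Real.exp (-(b * T)) ≤ pureDist u v - 2 * δ)
    (hψout : ∀ P : Matrix m m ℂ, P.PosSemidef → (1 - P).PosSemidef →
      |(P * 𝓐.output (tensorPower ψ k)).trace.re - (star u ⬝ᵥ (P *ᵥ u)).re| ≤ δ)
    (hφout : ∀ P : Matrix m m ℂ, P.PosSemidef → (1 - P).PosSemidef →
      |(P * 𝓐.output (tensorPower φ k)).trace.re - (star v ⬝ᵥ (P *ᵥ v)).re| ≤ δ) :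
    (c / C) ^ 2 * Real.exp (2 * (a - b) * T) ≤ k := by
  have hcexp : 0 < c * Real.exp (-(b * T)) := mul_pos hc (Real.exp_pos _)
  have hδ : 2 * δ ≤ pureDist u v := by linarith
  have h := copies_ge_sq_div 𝓐 hψ hφ hε0 hu hv hδ hψout hφout
  refine le_trans ?_ h
  -- `(c/C) e^{(a−b)T} ≤ (ε_f − 2δ)/ε₀`
  have hratio : c / C * Real.exp ((a - b) * T) ≤ (pureDist u v - 2 * δ) / pureDist ψ φ := by
    rw [le_div_iff₀ hε0]
    calc c / C * Real.exp ((a - b) * T) * pureDist ψ φ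
        ≤ c / C * Real.exp ((a - b) * T) * (C * Real.exp (-(a * T))) :=
          mul_le_mul_of_nonneg_left hinit (by positivity)
      _ = c * Real.exp (-(b * T)) := by
          have e1 : Real.exp ((a - b) * T) * Real.exp (-(a * T)) = Real.exp (-(b * T)) := by
            rw [← Real.exp_add]; ring_nf
          have hC0 : C ≠ 0 := hC.ne'
          rw [← e1]
          field_simp
      _ ≤ pureDist u v - 2 * δ := hsep
  have hsq := pow_le_pow_left₀ (by positivity) hratio 2
  have e2 : (c / C * Real.exp ((a - b) * T)) ^ 2 = (c / C) ^ 2 * Real.exp (2 * (a - b) * T) := by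
    rw [mul_pow, ← Real.exp_nat_mul]; ring_nf
  rwa [e2] at hsq

end Literature.Barriers.QuantumAdvantage.FluidDynamicsCopies

end
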